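import Summits.QuantumFields.YangMills.Theorems.IR.Negative.OnsetFormatsUcTransfer
import Summits.QuantumFields.YangMills.Theorems.OneCertifiedCubeFiniteSizeCriterionRecursion
import Summits.QuantumFields.YangMills.Theorems.BalabanLadderIRFrameCells
import Summits.QuantumFields.YangMills.Theorems.BalabanLadderIRGaugeImageBlind
import Summits.QuantumFields.YangMills.Theorems.BalabanLadderIRUnivShellCondSmallBeta
import Mathlib.Analysis.SpecificLimits.Normed
import HarnessLib

/-!
# Crux `IR` (stmt-QuantumFields-19354), line `af-pincer-Uc`: the DOBRUSHIN–SHLOSMAN BOOTSTRAP of the universal shell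
# condition on general frames, and `OnsetMixing ⇒ OnsetMixingTypicalUKPc` (the expired slot's stub I implies `stub_onsetUc`)

Helper module for item `stmt-QuantumFields-19354` (`--supports`; it closes nothing); lead prover of the line.  Route-independent
(written against the disprover's tree mirrors `OnsetFormats.UnivShellCond` / `OnsetMixing` — slot g0 022967c699dbe563 :82/:112
verbatim — and `OnsetFormatsUc.TypShellCondUKPc` / `OnsetMixingTypicalUKPc` — slot Uc :222/:266 verbatim, `=` the slot's own
`AfPincerUc.*` by S1's `Iff.rfl` bridges).

THE POINT.  The Uc stub's admissibility constant is the engine's `ε · shellCount n ≤ 3/4`; the expired universal stub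
`OnsetMixing` (and crux stmt-QuantumFields-16178 `CertificationLength.CompleteAnalyticityAtLargeScales`) carry the
Dobrushin–Shlosman threshold `ε · shellCount n < 1`.  The gap is closed by the tree's own block recursion
(`FiniteSizeCriterion.recursion_decay`, item 8895's engine) run on the cells of a GENERAL mesh-`b` frame
(`CellTempered.Engine.frameCell`, `frame_hC1`, `finite_frameCell`, `regionEdges_union` of `Theorems/BalabanLadderIRFrameCells`):

* §1 `frameFS_of_univShellCond` — `UnivShellCond ρ β b n ε` (all mesh-`b` frames, hence all SHIFTS of a frame `w`) is the
  recursion's finite-size hypothesis `hFS` for the cell map `frameCell w` (the general-frame twin of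
  `FiniteSizeCriterion.gridFS_of_frameFS`; proof pattern of `CellTempered.Engine.hFS_of_mix`).
* §2 `univShellCond_bootstrap` — **`UnivShellCond ρ β b n ε → UnivShellCond ρ β b (j·(2n+1)) ((ε·shellCount n)^j)`** for every
  `j` (`b ≥ 1`, `ε ≥ 0`, continuous `ρ`, Hausdorff second-countable `G`): boundary data agreeing off the region within cell
  distance `j(2n+1)` of the centre move the centre-cell law by at most `(εM)^j` (`recursion_decay` at `Λ = regionEdges w Y`,
  an arbitrary cell union — the recursion is shape-blind).
* §3 `exists_bootstrap_exponent` — `0 ≤ q < 1 ⇒ ∃ j ≥ 1, q^j · shellCount (j(2n+1)) ≤ 3/4` (geometric beats quartic,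
  Mathlib `tendsto_pow_const_mul_const_pow_of_abs_lt_one`).
* §4 **`onsetMixingTypicalUKPc_of_onsetMixing : OnsetFormats.OnsetMixing → OnsetFormatsUc.OnsetMixingTypicalUKPc`** — the
  expired slot's universal stub I implies the registered stub I^{Uc} (class `Typ ≡ univ`, `typShellCondUKPc_of_univShellCond`,
  every `δ`): together with the disprover's `onsetMixingTypical_of_UKPc` the three onset statements are now linearly ordered
  in the kernel, `OnsetMixing ⇒ OnsetMixingTypicalUKPc ⇒ OnsetMixingTypical`.  The route-tied corollary
  `CompleteAnalyticityAtLargeScales ⇒ AfPincerUc.OnsetMixingTypicalUKPc` (crux 16178 closes `stub_onsetUc`) is the sibling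
  `Theorems/IR/AfPincerUcOfCALS`.

HONEST FRAMING: a constant-bootstrap between registered FORMATS of one open gap-crux; the universal shell condition at a
β-dependent mesh (weak-coupling complete analyticity beyond the correlation length) is assumed, never proved; conditional
chain above the crux untouched; not a gap, not Clay.  No `sorry`; axioms ⊆ {propext, Classical.choice, Quot.sound}.
-/

set_option autoImplicit false

noncomputable section

open MeasureTheory Filter Topology
open Literature.MathematicalPhysics
open Literature.MathematicalPhysics.QuantumFieldTheory Literature.MathematicalPhysics.QuantumLattice
open Literature.Probability.LatticeModels
open Summit.QuantumFields.YangMills.Cruxes.IR.Tempered (cellEdges windowCells regionEdges)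
open Summit.QuantumFields.YangMills.Cruxes.IR.ShellTempered (windowCellsPlus)
open Summit.QuantumFields.YangMills.Cruxes.IR.CellTempered.Engine (frameCell frameCell_eq_iff mem_cellEdges_frameCell
  frame_hC1 finite_frameCell regionEdges_union shiftFrame shiftFrame_mesh cellEdges_shiftFrame)
open Summit.QuantumFields.YangMills.Cruxes.IR.OnsetFormats (shellCount UnivShellCond OnsetMixing)
open Summit.QuantumFields.YangMills.Cruxes.IR.OnsetFormatsUc (TypShellCondUKPc OnsetMixingTypicalUKPc
  typShellCondUKPc_of_univShellCond)
open Summit.QuantumFields.YangMills.Theorems.FiniteSizeCriterion (recursion_decay)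
open Summit.QuantumFields.YangMills.Cruxes.IR.CruxIdea2g3 (frame_one_of_mesh)
open Summit.QuantumFields.YangMills.Cruxes.IR.AfPincerUc.Calibration (windowCells_subset_windowCellsPlus)

namespace Summit.QuantumFields.YangMills.Cruxes.IR.AfPincerUc.Bootstrap

variable {G : Type} [Group G] [TopologicalSpace G] [IsTopologicalGroup G] [CompactSpace G]
  [MeasurableSpace G] [BorelSpace G] {N : ℕ} (ρ : G →* Matrix (Fin N) (Fin N) ℂ)

/-! ## §1 The universal shell condition is the block recursion's finite-size hypothesis on frame cells -/

/-- **`UnivShellCond` ⇒ hypothesis `hFS` of `FiniteSizeCriterion.recursion_decay` for the cell map `frameCell w`** of any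
mesh-`b` frame `w` (`b ≥ 1`): the condition at centre `x` is the universal shell condition of the SHIFTED frame
`shiftFrame w x` at its centre `0`. -/
theorem frameFS_of_univShellCond {β : ℝ} {b n : ℕ} (hb : 1 ≤ b) {ε : ℝ} (hU : UnivShellCond ρ β b n ε)
    {w : Fin 4 → ℤ → ℤ} (hw : ∀ i j, w i j + ((b : ℕ) : ℤ) ≤ w i (j + 1) ∧ w i (j + 1) ≤ w i j + 2 * ((b : ℕ) : ℤ))
    (x : Fin 4 → ℤ) (Λ₀ : Finset (QuantumLattice.ZdEdge 4))
    (hunion : ∀ v v', frameCell w v = frameCell w v' → v ∈ Λ₀ → v' ∈ Λ₀)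
    (hnear : ∀ v ∈ Λ₀, ∀ i, |frameCell w v i - x i| ≤ 2 * n) (hx : ∀ v, frameCell w v = x → v ∈ Λ₀)
    (η η' : LGConfig 4 G) (hagree : ∀ v, (∀ i, |frameCell w v i - x i| ≤ 2 * n) → η v = η' v)
    (f : LGConfig 4 G → ℝ) (hfdep : DependsOn f {v | frameCell w v = x}) (hfm : Measurable f)
    (hf01 : ∀ σ, 0 ≤ f σ ∧ f σ ≤ 1) :
    |∫ σ, f σ ∂(ymSpecification ρ β Λ₀ η) - ∫ σ, f σ ∂(ymSpecification ρ β Λ₀ η')| ≤ ε := by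
  classical
  have hw1 := frame_one_of_mesh hb hw
  -- the cells of the shifted frame are the cells of `w`, re-indexed
  have hmem : ∀ (y : Fin 4 → ℤ) (e : QuantumLattice.ZdEdge 4),
      e ∈ cellEdges (shiftFrame w x) y ↔ frameCell w e = y + x := by
    intro y e
    rw [cellEdges_shiftFrame, frameCell_eq_iff hw1]
  -- the cells met by `Λ₀`, recentred
  set Y : Finset (Fin 4 → ℤ) := Λ₀.image fun v => frameCell w v - x with hY
  have hYsub : Y ⊆ windowCells n := by
    intro y hy
    obtain ⟨v, hv, rfl⟩ := Finset.mem_image.1 hy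
    simp only [Summit.QuantumFields.YangMills.Cruxes.IR.Tempered.windowCells, Fintype.mem_piFinset,
      Finset.mem_Icc, Pi.sub_apply]
    intro i
    have h := abs_le.1 (hnear v hv i)
    exact ⟨h.1, h.2⟩
  have hcx : frameCell w ((fun i => w i (x i)), (0 : Fin 4)) = x := by
    rw [frameCell_eq_iff hw1]
    simp only [Summit.QuantumFields.YangMills.Cruxes.IR.Tempered.cellEdges, Finset.mem_product,
      Finset.mem_univ, and_true, Fintype.mem_piFinset, Finset.mem_Ico]
    intro i
    exact ⟨le_rfl, by linarith [hw1 i (x i)]⟩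
  have h0Y : (0 : Fin 4 → ℤ) ∈ Y :=
    Finset.mem_image.2 ⟨_, hx _ hcx, by rw [hcx, sub_self]⟩
  have hbiU : regionEdges (shiftFrame w x) Y = Λ₀ := by
    ext e
    simp only [Summit.QuantumFields.YangMills.Cruxes.IR.Tempered.regionEdges, Finset.mem_biUnion]
    constructor
    · rintro ⟨y, hy, he⟩
      obtain ⟨v, hv, rfl⟩ := Finset.mem_image.1 hy
      rw [hmem, sub_add_cancel] at he
      exact hunion v e he.symm hv
    · intro he
      refine ⟨frameCell w e - x, Finset.mem_image.2 ⟨e, he, rfl⟩, ?_⟩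
      rw [hmem, sub_add_cancel]
  -- the universal shell condition's agreement clause: cells of the window (off `Y` or not)
  have hpair : ∀ c ∈ windowCellsPlus n, c ∉ Y → c ∈ windowCells n →
      ∀ e ∈ cellEdges (shiftFrame w x) c, η e = η' e := by
    intro c _ _ hcW e he
    rw [hmem] at he
    refine hagree e fun i => ?_
    have hci := Finset.mem_Icc.1 (Fintype.mem_piFinset.1 hcW i)
    rw [he, Pi.add_apply, add_sub_cancel_right, abs_le]
    exact ⟨hci.1, hci.2⟩
  have hcyl : IsCylinder f (cellEdges (shiftFrame w x) 0) := by
    intro σ σ' h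
    refine hfdep fun v hv => h v ?_
    rw [Finset.mem_coe, hmem, zero_add]
    exact hv
  have key := hU (shiftFrame w x) (shiftFrame_mesh hw x) Y hYsub h0Y η η' hpair f hcyl hfm hf01
  rwa [hbiU] at key

/-! ## §2 The bootstrap: window `j(2n+1)`, threshold `(ε M)^j` -/

/-- The recursion's shell count is `shellCount n` (`(4n+3)⁴ − (4n+1)⁴`). -/
theorem recursionCount_eq_shellCount (n : ℕ) :
    ((((2 * (2 * n + 1) + 1) ^ 4 - (2 * (2 * n) + 1) ^ 4 : ℕ)) : ℝ) = shellCount n := by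
  have h1 : 2 * (2 * n + 1) + 1 = 4 * n + 3 := by ring
  have h2 : 2 * (2 * n) + 1 = 4 * n + 1 := by ring
  rw [h1, h2]
  rfl

variable [SecondCountableTopology G] [T2Space G]

/-- **THE BOOTSTRAP.**  For continuous `ρ` on a Hausdorff second-countable compact group, `b ≥ 1`, `ε ≥ 0`:
`UnivShellCond ρ β b n ε → UnivShellCond ρ β b (j·(2n+1)) ((ε · shellCount n)^j)` for every `j` — the Dobrushin–Shlosman
block recursion (`FiniteSizeCriterion.recursion_decay`) on the cells of each mesh-`b` frame, applied to the ARBITRARY cell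
union `regionEdges w Y` and the centre cell `0`. -/
theorem univShellCond_bootstrap (hρ : Continuous ρ) {β : ℝ} {b n : ℕ} (hb : 1 ≤ b) {ε : ℝ} (hε : 0 ≤ ε)
    (hU : UnivShellCond ρ β b n ε) (j : ℕ) :
    UnivShellCond ρ β b (j * (2 * n + 1)) ((ε * shellCount n) ^ j) := by
  intro w hw Y hY h0 σ σ' hagree f hf hfm hf01
  have hw1 := frame_one_of_mesh hb hw
  have hγ := isSpecification_ymSpecification_of_t2Space (d := 4) ρ hρ β
  have hfdep : DependsOn f {v | frameCell w v = 0} := fun U V h =>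
    hf fun e he => h e ((frameCell_eq_iff hw1 e 0).2 (Finset.mem_coe.1 he))
  have hagree' : ∀ v, v ∉ regionEdges w Y → (∀ i, |frameCell w v i - (0 : Fin 4 → ℤ) i| ≤ j * (2 * n + 1)) →
      σ v = σ' v := by
    intro v hv hd
    set c := frameCell w v with hc
    have hvc : v ∈ cellEdges w c := mem_cellEdges_frameCell hw1 v
    have hcW : c ∈ windowCells (j * (2 * n + 1)) := by
      simp only [Summit.QuantumFields.YangMills.Cruxes.IR.Tempered.windowCells, Fintype.mem_piFinset, Finset.mem_Icc]
      intro i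
      have h := abs_le.1 (hd i)
      simp only [Pi.zero_apply, sub_zero] at h
      push_cast
      constructor <;> linarith [h.1, h.2]
    have hcY : c ∉ Y := fun hcY => hv (Finset.mem_biUnion.2 ⟨c, hcY, hvc⟩)
    exact hagree c (windowCells_subset_windowCellsPlus _ hcW) hcY hcW v hvc
  have h := recursion_decay (d := 4) hγ
    (fun Λ g T hg hT => dependsOn_integral_ymSpecification ρ hρ β Λ hg hT)
    (cell := frameCell w) (frame_hC1 hw1) (finite_frameCell hw1) hε
    (frameFS_of_univShellCond ρ hb hU hw) j (regionEdges w Y) (regionEdges_union hw1 Y) 0 f hfm hf01 hfdep σ σ'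
    hagree'
  rwa [recursionCount_eq_shellCount] at h

/-! ## §3 Geometric beats quartic: the bootstrap exponent -/

omit [SecondCountableTopology G] [T2Space G] in
/-- `shellCount m ≤ (4m+3)⁴`. -/
theorem shellCount_le (m : ℕ) : shellCount m ≤ (4 * (m : ℝ) + 3) ^ 4 := by
  unfold Summit.QuantumFields.YangMills.Cruxes.IR.OnsetFormats.shellCount
  have h : ((4 * m + 3) ^ 4 - (4 * m + 1) ^ 4 : ℕ) ≤ (4 * m + 3) ^ 4 := Nat.sub_le _ _
  exact_mod_cast h

omit [SecondCountableTopology G] [T2Space G] in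
/-- **The bootstrap exponent**: for `0 ≤ q < 1` and any `n` there is `j ≥ 1` with `q^j · shellCount (j(2n+1)) ≤ 3/4`. -/
theorem exists_bootstrap_exponent {q : ℝ} (hq0 : 0 ≤ q) (hq1 : q < 1) (n : ℕ) :
    ∃ j : ℕ, 1 ≤ j ∧ q ^ j * shellCount (j * (2 * n + 1)) ≤ 3 / 4 := by
  -- `shellCount (j(2n+1)) ≤ (7(2n+1))⁴ · j⁴` for `j ≥ 1`
  set C : ℝ := (7 * (2 * (n : ℝ) + 1)) ^ 4 with hC
  have hCq : ∀ j : ℕ, 1 ≤ j → q ^ j * shellCount (j * (2 * n + 1)) ≤ C * ((j : ℝ) ^ 4 * q ^ j) := by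
    intro j hj
    have hj' : (1 : ℝ) ≤ j := by exact_mod_cast hj
    have hS := shellCount_le (j * (2 * n + 1))
    have hle : (4 * ((j * (2 * n + 1) : ℕ) : ℝ) + 3) ^ 4 ≤ C * (j : ℝ) ^ 4 := by
      have h7 : 4 * ((j * (2 * n + 1) : ℕ) : ℝ) + 3 ≤ 7 * (2 * (n : ℝ) + 1) * j := by
        push_cast
        nlinarith
      have h0 : 0 ≤ 4 * ((j * (2 * n + 1) : ℕ) : ℝ) + 3 := by positivity
      calc (4 * ((j * (2 * n + 1) : ℕ) : ℝ) + 3) ^ 4 ≤ (7 * (2 * (n : ℝ) + 1) * j) ^ 4 :=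
            pow_le_pow_left₀ h0 h7 4
        _ = C * (j : ℝ) ^ 4 := by rw [hC]; ring
    have hqj : 0 ≤ q ^ j := pow_nonneg hq0 j
    calc q ^ j * shellCount (j * (2 * n + 1)) ≤ q ^ j * (C * (j : ℝ) ^ 4) :=
          mul_le_mul_of_nonneg_left (hS.trans hle) hqj
      _ = C * ((j : ℝ) ^ 4 * q ^ j) := by ring
  -- `j⁴ q^j → 0`
  have hlim : Tendsto (fun j : ℕ => C * ((j : ℝ) ^ 4 * q ^ j)) atTop (𝓝 0) := by
    have h := tendsto_pow_const_mul_const_pow_of_abs_lt_one 4 (abs_lt.2 ⟨by linarith, hq1⟩)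
    simpa using h.const_mul C
  obtain ⟨J, hJ⟩ := Metric.tendsto_atTop.1 hlim (3 / 4) (by norm_num)
  refine ⟨max J 1, le_max_right _ _, ?_⟩
  have h1 := hJ (max J 1) (le_max_left _ _)
  rw [Real.dist_eq, sub_zero] at h1
  exact (hCq _ (le_max_right _ _)).trans (le_of_lt (lt_of_abs_lt h1))

/-! ## §4 The expired universal stub implies the registered Uc stub -/

omit [SecondCountableTopology G] [T2Space G] in
/-- **`OnsetMixing → OnsetMixingTypicalUKPc`.**  For each `(G, r)`: take `OnsetMixing`'s `(n, ε)` with `ε · shellCount n < 1`,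
the bootstrap exponent `j`, and the admissible pair `(j(2n+1), (ε · shellCount n)^j)` — its threshold times
`shellCount (j(2n+1))` is `≤ 3/4`; at every `β ≥ β₂` the universal mesh `b` of `OnsetMixing` bootstraps to the new window
(`univShellCond_bootstrap`) and the universal condition is format Uc at every `δ` (`typShellCondUKPc_of_univShellCond`). -/
theorem onsetMixingTypicalUKPc_of_onsetMixing (h : OnsetMixing) : OnsetMixingTypicalUKPc := by
  intro G _ _ _ _ hG
  letI : MeasurableSpace G := borel G
  haveI : BorelSpace G := ⟨rfl⟩
  intro r
  haveI : T2Space G := T2Space.of_injective_continuous r.injective r.continuous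
  haveI : SecondCountableTopology G :=
    (r.continuous.isClosedEmbedding r.injective).isEmbedding.secondCountableTopology
  obtain ⟨n, ε, hn, hε, hlt, β₂, hβ⟩ := h G hG r
  have hq0 : 0 ≤ ε * shellCount n := by
    unfold Summit.QuantumFields.YangMills.Cruxes.IR.OnsetFormats.shellCount
    positivity
  obtain ⟨j, hj1, hj⟩ := exists_bootstrap_exponent hq0 hlt n
  refine ⟨j * (2 * n + 1), (ε * shellCount n) ^ j, ?_, pow_nonneg hq0 j, hj, fun δ _ => ⟨β₂, fun β hb => ?_⟩⟩
  · calc 1 ≤ j := hj1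
      _ ≤ j * (2 * n + 1) := Nat.le_mul_of_pos_right j (by omega)
  · obtain ⟨b, hb1, hU⟩ := hβ β hb
    exact ⟨b, hb1, typShellCondUKPc_of_univShellCond (univShellCond_bootstrap r.ρ r.continuous hb1 hε hU j) δ⟩

end Summit.QuantumFields.YangMills.Cruxes.IR.AfPincerUc.Bootstrap

end
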